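import Literature.Probability.RandomPlanarGeometry.CritPercSLE
import Literature.Probability.RandomPlanarGeometry.SLEExistenceConverse
import HarnessLib

/-!
# What the locality characterisation carries: SLE_κ trace theorems for every `κ ≠ 6`

Topic `Probability/RandomPlanarGeometry`; theorems only. A converse-direction companion of the
named fact `Literature.Probability.RandomPlanarGeometry.eq_six_of_forall_measureReal_hitsBefore`
(**crit-perc.S21**, `CritPercSLE`; Werner (2007), Sect. 3 §2 p. 19: "SLE(6) is the only SLE with
this property"), in the spirit of `SLEExistenceConverse` for `exists_isSLECurve`.

The fact reads: if `κ > 0` and *every* SLE_κ law `μ` (`IsSLELaw κ (R.chord 0 2) μ`) in *every*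
conformal rectangle satisfies Cardy's crossing formula, then `κ = 6`. Since `IsSLELaw` packages
"the Loewner chain of `√κ B` is almost surely generated by its trace" (through `IsSLECurve`), the
hypothesis is vacuous for a value of `κ` for which no SLE_κ law exists. Consequently the fact, read
contrapositively at a fixed `κ ≠ 6`, *produces* an SLE_κ law (violating Cardy's formula) and with
it:

* `hasSLETrace_of_eq_six_of_forall_measureReal_hitsBefore`: SLE_κ is generated by a curve for every
  `κ > 0`, `κ ≠ 6` — the Rohde–Schramm theorem (Ann. Math. 161 (2005), Thm. 5.1) off `κ ∈ {6, 8}`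
  and, for `κ = 8`, the Lawler–Schramm–Werner theorem (Ann. Probab. 32 (2004), Thm. 4.7),
  `hasSLETrace_eight_of_eq_six_of_forall_measureReal_hitsBefore`;
* `ae_tendsto_norm_sleTrace_atTop_of_eq_six_of_forall_measureReal_hitsBefore`: the SLE_κ trace is
  almost surely transient for every `κ > 0`, `κ ≠ 6` (Rohde–Schramm (2005), Thm. 7.1).

So any proof of the named fact contains these trace theorems; together with the reductions of
`CritPercSLELocalityProofs` / `CritPercSLELocalityMartingaleProofs` (which consume
`exists_isSLECurve ↔ hasSLETrace_eight ∧ hasSLETrace_of_ne_eight ∧ tendsto_norm_sleTrace_atTop`,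
`exists_isSLECurve_iff`) this pins the literature content of the fact on the trace side exactly,
up to the single value `κ = 6`. The statement is faithful to the source (where SLE_κ is a random
curve throughout) but heavier than the printed "Cardy's formula computation for SLE", whose
rectangle-free core is `eq_six_of_forall_eq_cardyFunction` (`CritPercSLELocalityMartingaleProofs`).

## References

* W. Werner, *Lectures on two-dimensional critical percolation*, IAS/Park City (2007),
  arXiv:0710.0856, Sect. 3 §2 (p. 19).
* S. Rohde, O. Schramm, *Basic properties of SLE*, Ann. of Math. 161 (2005), Thm. 5.1, Thm. 7.1.
* G. Lawler, O. Schramm, W. Werner, *Conformal invariance of planar loop-erased random walks and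
  uniform spanning trees*, Ann. Probab. 32 (2004), Thm. 4.7.
-/

noncomputable section

open Set Filter Topology MeasureTheory
open UpperHalfPlane (upperHalfPlaneSet)
open scoped NNReal

namespace Literature.Probability.RandomPlanarGeometry

/-- **The named fact produces SLE_κ laws violating Cardy's formula, `κ ≠ 6`.** If
`eq_six_of_forall_measureReal_hitsBefore` holds, then for every `κ > 0` with `κ ≠ 6` there are a
conformal rectangle `R`, an SLE_κ law `μ` in `(Ω; a, c)` and a uniformizing datum `(φ, x)` of `R`
with `μ(hits (cd) before (bc)) ≠ F(crossRatio x)` — the contrapositive of the fact at `κ`. In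
particular an SLE_κ law exists. [folklore] -/
theorem exists_isSLELaw_of_eq_six_of_forall_measureReal_hitsBefore
    (h : eq_six_of_forall_measureReal_hitsBefore) {κ : ℝ≥0} (hκ : 0 < κ) (h6 : κ ≠ 6) :
    ∃ (R : ConformalRectangle) (μ : Measure (CurveClass ℂ))
      (φ : ConformalEquiv upperHalfPlaneSet R.carrier) (x : Fin 4 → ℝ),
      IsSLELaw κ (R.chord 0 2 (by decide)) μ ∧ R.IsUniformizing φ x ∧
        μ.real (CurveClass.hitsBefore (R.arc 2) (R.arc 1)) ≠ cardyFunction (crossRatio x) := by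
  by_contra hne
  push Not at hne
  exact h6 (h hκ fun R μ φ x hμ hφ ↦ hne R μ φ x hμ hφ)

/-- **The named fact implies that SLE_κ is generated by a curve for every `κ > 0`, `κ ≠ 6`**
(the Rohde–Schramm theorem, Thm. 5.1, for `κ ∉ {6, 8}`, and the Lawler–Schramm–Werner theorem for
`κ = 8`): an SLE_κ law in a Dobrushin domain witnesses `HasSLETrace κ` (`IsSLELaw.hasSLETrace`).
Hence no proof of `eq_six_of_forall_measureReal_hitsBefore` can avoid the trace theorems.
[cite: RohdeSchramm2005, Thm 5.1] -/
theorem hasSLETrace_of_eq_six_of_forall_measureReal_hitsBefore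
    (h : eq_six_of_forall_measureReal_hitsBefore) {κ : ℝ≥0} (hκ : 0 < κ) (h6 : κ ≠ 6) :
    HasSLETrace κ := by
  obtain ⟨R, μ, -, -, hμ, -, -⟩ := exists_isSLELaw_of_eq_six_of_forall_measureReal_hitsBefore h hκ h6
  exact hμ.hasSLETrace

/-- **The named fact implies the Lawler–Schramm–Werner theorem on SLE₈** (`hasSLETrace_eight`,
Lawler–Schramm–Werner (2004), Thm. 4.7): the case `κ = 8 ≠ 6` of
`hasSLETrace_of_eq_six_of_forall_measureReal_hitsBefore`. [cite: LawlerSchrammWerner2004, Thm 4.7] -/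
theorem hasSLETrace_eight_of_eq_six_of_forall_measureReal_hitsBefore
    (h : eq_six_of_forall_measureReal_hitsBefore) : hasSLETrace_eight :=
  hasSLETrace_of_eq_six_of_forall_measureReal_hitsBefore h (by norm_num) (by norm_num)

/-- **The named fact implies `hasSLETrace_of_ne_eight` off `κ = 6`**: for `κ ∉ {6, 8}`, SLE_κ is
generated by a curve (Rohde–Schramm (2005), Thm. 5.1); `κ = 0` is the proved `hasSLETrace_zero`.
[cite: RohdeSchramm2005, Thm 5.1] -/
theorem hasSLETrace_of_ne_six_of_eq_six_of_forall_measureReal_hitsBefore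
    (h : eq_six_of_forall_measureReal_hitsBefore) {κ : ℝ≥0} (h6 : κ ≠ 6) : HasSLETrace κ := by
  rcases eq_or_ne κ 0 with rfl | h0
  · exact hasSLETrace_zero
  · exact hasSLETrace_of_eq_six_of_forall_measureReal_hitsBefore h (pos_iff_ne_zero.2 h0) h6

/-- **The named fact implies transience of the SLE_κ trace for every `κ > 0`, `κ ≠ 6`**
(Rohde–Schramm (2005), Thm. 7.1): an SLE_κ random curve in a Dobrushin domain has almost surely a
transient trace (`IsSLECurve.ae_tendsto_norm_sleTrace_atTop`: its compactified image is continuous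
at the target corner). [cite: RohdeSchramm2005, Thm 7.1] -/
theorem ae_tendsto_norm_sleTrace_atTop_of_eq_six_of_forall_measureReal_hitsBefore
    (h : eq_six_of_forall_measureReal_hitsBefore) {κ : ℝ≥0} (hκ : 0 < κ) (h6 : κ ≠ 6) :
    ∀ᵐ ω ∂Process.preWienerMeasure, Tendsto (fun t ↦ ‖sleTrace κ ω t‖) atTop atTop := by
  obtain ⟨R, μ, -, -, ⟨Γ, hΓ, -⟩, -, -⟩ :=
    exists_isSLELaw_of_eq_six_of_forall_measureReal_hitsBefore h hκ h6
  exact hΓ.ae_tendsto_norm_sleTrace_atTop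

end Literature.Probability.RandomPlanarGeometry
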